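import Literature.Analysis.FluidPDE.NSFiniteEnergySmoothProofs
import Literature.Analysis.FluidPDE.LerayHopfProofs
import Literature.Analysis.FluidPDE.NSWeakStrongUniquenessProofs
import Literature.Analysis.FluidPDE.ClassicalSolutionGlue
import HarnessLib

/-!
# Finite energy classical solutions of Navier–Stokes on `ℝ³` are Leray–Hopf solutions
# (Tao 2011, Lemma 8.1 in the sharp form, with Lemma 4.1 (i)) — PROVED

For a classical solution `(u, p)` of the unforced Navier–Stokes system on the closed slab
`[0, T] × ℝ³` (`Fluid.IsClassicalNSSolutionOn (Icc 0 T) ν 0 u p`, `ν > 0`, `T > 0`) of finite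
energy in Tao's sense ((6): `sup_{t ∈ [0,T]} ∫|u(t)|² < ∞`, arXiv:1108.1165, p. 3), this file
proves:

* the **energy equality** `½‖u(t)‖₂² + ν∫ₛᵗ∫|∇u|² = ½‖u(s)‖₂²` for all `0 ≤ s ≤ t ≤ T`
  (`IsClassicalNSSolutionOn.energyEq_of_finiteEnergy`) — the sharp form of Tao's Lemma 8.1
  (arXiv Lemma 44 with (8.2): `‖u‖_{L^∞_t L²_x} + ‖∇u‖_{L²_t L²_x} ≲ E^{1/2}`), i.e. Leray's
  "relation de dissipation de l'énergie" (Leray 1934, (3.4)) for this class;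
* `u ∈ C([0, T]; L²)` (`Fluid.ContinuousInLpOn`), and
* `u` is a **Leray–Hopf weak solution** on `[0, T)` from `u(0)` (`Fluid.IsLerayHopfOn`), together
  with all its time translates `u(· + t')`, `0 ≤ t' < T`, from `u(t')`
  (`NS.isLerayHopfOn_of_finiteEnergy`, `NS.isLerayHopfOn_translate_of_finiteEnergy`) —
  **unconditionally**: the three inputs, Tao's pressure normalisation (Lemma 4.1 (i),
  `NS.tao_pressure_normalisation_holds`), the estimate of the pressure term `X₅` of the proof of
  Lemma 8.1 (`NS.tao2011_pressureTerm_estimate`, here `NS.tao2011_pressureTerm_estimate_holds` from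
  `tao2011_pressureTerm_estimate_of_riesz` and the discharged singular-integral inputs) and
  Lemma 8.1 itself (`NS.tao_finite_energy_smooth_energy_bound_holds`) are theorems of the tree.

This is the input "`u` is Leray–Hopf" of the weak–strong continuation route to Tao's Cor. 11.1
(`NS.tao2011_hasBoundedSobolevNormsOn`): it allows the proved Prodi–Serrin weak–strong uniqueness
theorem (`NS.serrin_weak_strong_uniqueness_holds`) to identify `u` with the local strong solutions
of Thm. 5.4.

## The argument

1. *Energy class* (Lemma 8.1): `sup_t ∫|u(t)|² ≤ A`, `ν∫₀ᵀ∫|∇u|² ≤ A`, `A = C∫|u₀|² < ∞`; hence,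
   by the Sobolev inequality `H¹ ⊂ L⁶` on the slices and Lebesgue interpolation,
   `∫₀ᵀ∫|u|³ ≤ A^{3/4}K^{3/2}(T + ∫₀ᵀ∫|∇u|²) < ∞` (`lintegral_enorm_pow_three_lt_top`).
2. *Energy equality.* The localised energy balance of the tree
   (`IsClassicalNSSolutionOn.energy_balance_cutoff`, Leray's (3.4) localised) against the Tao
   cut-offs `φ_n = θ⁸_{4(n+1), n+1}` (`NS.taoCutoff`; `φ_n = 1` on `B̄(0, 3(n+1))`,
   `|Dφ_n| ≤ 8C₁/(n+1)`), and `n → ∞`: the transported energy `½∫∫(Dφ_n·u)|u|²` and the viscous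
   cross term are `O(1/n)` by the `L³_{t,x}` and `L²` bounds, exactly as in the tree's
   `IsClassicalNSSolutionOn.energyEq`; the kinetic and dissipation terms converge by dominated
   convergence. The **pressure term** `∫∫ p (Dφ_n·u)` — for which no global integrability of the
   given pressure `p` is available — is handled by Lemma 4.1 (i): for a.e. `τ`,
   `p(τ) = p̃[u(τ)] + C(τ)` with `p̃` the normalised pressure, the constant dropping out against the
   divergence-free `u` ((54); `integral_pressure_shift_eq`), and by the estimate of `X₅`:
   `|∫ p̃[u(τ)] Dφ_n(u(τ))| ≤ ε∫|∇u(τ)|² + C₅(εA/r_n² + A³/(ε³r_n⁴))` for **every** `ε > 0`, so that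
   `limsup_n |∫ₛᵗ∫ p Dφ_n(u)| ≤ ε∫ₛᵗ∫|∇u|²` for every `ε`, i.e. the pressure contribution vanishes
   in the limit (whereas the printed proof of Lemma 8.1 takes `ε = ν/4` and absorbs).
3. *Continuity in `L²`*: `t ↦ ½‖u(t)‖²` is continuous (energy equality and absolute continuity of
   the finite dissipation integral), `t ↦ ∫⟪u(t), w⟫` is continuous for `w ∈ L²` (compactly
   supported continuous approximants, dominated convergence, uniform `L²` bound), whence
   `‖u(t) - u(t₀)‖₂² = ‖u(t)‖₂² - 2∫⟪u(t), u(t₀)⟫ + ‖u(t₀)‖₂² → 0` (Radon–Riesz).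
4. *Leray–Hopf structure*: weak formulation (`isWeakNSSolutionOn_holds`), classical gradient as
   weak gradient (`hasWeakGradient_fderiv_of_contDiff`), energy inequalities from the equality,
   weak/strong continuity from 3 (as in the tree's `isLerayHopfOn_holds`, whose hypothesis
   `p u ∈ L¹_{t,x}` on the *given* pressure is not available here). Time translates by autonomy
   (`IsClassicalNSSolutionOn.comp_add_right`).

## Mathlib / tree search

Tree: `IsClassicalNSSolutionOn.isLerayHopfOn_holds` (`LerayHopfProofs`) needs
`∫∫|p||u| < ∞` for the given `p` — not available for Tao's class (the pressure is normalised only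
up to `C(t)`); `IsClassicalNSSolutionOn.energyEq` likewise. `NS.tao_finite_energy_smooth_energy_bound`
gives the energy *inequality* with an absolute constant only. No prior `isLerayHopfOn` result for
finite energy classical solutions (`lean search 'isLerayHopfOn_of|finiteEnergy'`). Mathlib:
`tendsto_setLIntegral_zero`, `MemLp.exists_hasCompactSupport_eLpNorm_sub_le`,
`continuousOn_integral_of_compact_support`, `ENNReal.lintegral_mul_le_Lp_mul_Lq`, `norm_sub_sq_real`.

## References

* T. Tao, *Localisation and compactness properties of the Navier–Stokes global regularity
  problem*, Anal. PDE 6 (2013) 25–107 = arXiv:1108.1165 (`Tao2011`): (6) p. 3; Lemma 4.1 (i)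
  (arXiv Lemma 25, p. 14); Lemma 8.1 (arXiv Lemma 44, p. 24) and its proof, §8, (54), (58)–(65) (held arXiv copy pp. 24–27).
* J. Leray, *Sur le mouvement d'un liquide visqueux emplissant l'espace*, Acta Math. 63 (1934)
  (`Leray1934`): §17 (3.4) (energy equality for regular solutions), §32.
* J. C. Robinson, J. L. Rodrigo, W. Sadowski, *The Three-Dimensional Navier–Stokes Equations*,
  CUP 2016 (`RobinsonRodrigoSadowski2016`): Def. 4.9 (Leray–Hopf weak solutions), Thm. 4.6.
-/

open MeasureTheory Set Filter Topology
open scoped ENNReal NNReal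

namespace Literature.Analysis.FluidPDE

/-! ## Slices of finite energy: `L²`, `L³` -/

section Slices

/-- A continuous slice with `∫ |v|² < ⊤` is in `L²`. [folklore] -/
theorem memLp_two_of_lintegral_lt_top {v : (EuclideanSpace ℝ (Fin 3)) → (EuclideanSpace ℝ (Fin 3))} (hv : Continuous v)
    (h : ∫⁻ x, ‖v x‖ₑ ^ 2 < ⊤) : MemLp v 2 volume := by
  refine (memLp_two_iff_integrable_sq_norm hv.aestronglyMeasurable).2
    ⟨(hv.norm.pow 2).aestronglyMeasurable, ?_⟩
  refine (hasFiniteIntegral_iff_enorm).2 (lt_of_le_of_lt (le_of_eq ?_) h)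
  refine lintegral_congr fun x => ?_
  rw [Real.enorm_eq_ofReal (sq_nonneg _), ← ofReal_norm, ENNReal.ofReal_pow (norm_nonneg _)]

/-- **The `L³` slice bound** (Lebesgue interpolation `‖v‖₃ ≤ ‖v‖₂^{1/2}‖v‖₆^{1/2}` and the Sobolev
inequality `‖v‖₆ ≤ K ‖∇v‖₂` on `ℝ³`): for a `C¹` slice `v ∈ L²` with `∫|v|² ≤ A`,
`∫ |v|³ ≤ A^{3/4} K^{3/2} (∫|∇v|²)^{3/4}`. [folklore] -/
theorem lintegral_enorm_pow_three_le {v : (EuclideanSpace ℝ (Fin 3)) → (EuclideanSpace ℝ (Fin 3))} (hv : ContDiff ℝ 1 v) {A : ℝ≥0∞}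
    (hA : ∫⁻ x, ‖v x‖ₑ ^ 2 ≤ A) (hAt : A ≠ ⊤) :
    ∫⁻ x, ‖v x‖ₑ ^ (3 : ℕ) ≤
      A ^ (3 / 4 : ℝ) * ((SNormLESNormFDerivOfEqConst (EuclideanSpace ℝ (Fin 3)) (volume : Measure (EuclideanSpace ℝ (Fin 3))) 2 : ℝ≥0∞) ^ (3 / 2 : ℝ) *
        (∫⁻ x, ENNReal.ofReal (frobeniusNormSq (fderiv ℝ v x))) ^ (3 / 4 : ℝ)) := by
  set K : ℝ≥0∞ := (SNormLESNormFDerivOfEqConst (EuclideanSpace ℝ (Fin 3)) (volume : Measure (EuclideanSpace ℝ (Fin 3))) 2 : ℝ≥0∞) with hK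
  set D : ℝ≥0∞ := ∫⁻ x, ENNReal.ofReal (frobeniusNormSq (fderiv ℝ v x)) with hD
  have hvc : Continuous v := hv.continuous
  have hmem : MemLp v 2 volume := memLp_two_of_lintegral_lt_top hvc (hA.trans_lt hAt.lt_top)
  have hmeas : AEMeasurable (fun x => ‖v x‖ₑ ^ (3 / 2 : ℝ)) (volume : Measure (EuclideanSpace ℝ (Fin 3))) :=
    (hvc.enorm.aemeasurable.pow_const _)
  -- Hölder with exponents `4/3` and `4`
  have hpq : (4 / 3 : ℝ).HolderConjugate 4 := by rw [Real.holderConjugate_iff]; norm_num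
  have hH := ENNReal.lintegral_mul_le_Lp_mul_Lq (volume : Measure (EuclideanSpace ℝ (Fin 3))) hpq hmeas hmeas
  have hprod : ∀ x, ((fun x => ‖v x‖ₑ ^ (3 / 2 : ℝ)) * fun x => ‖v x‖ₑ ^ (3 / 2 : ℝ)) x =
      ‖v x‖ₑ ^ (3 : ℕ) := by
    intro x
    simp only [Pi.mul_apply]
    rw [← ENNReal.rpow_add_of_nonneg _ _ (by norm_num) (by norm_num)]
    norm_num
  have h1 : ∀ x, (‖v x‖ₑ ^ (3 / 2 : ℝ)) ^ (4 / 3 : ℝ) = ‖v x‖ₑ ^ 2 := by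
    intro x
    rw [← ENNReal.rpow_mul]; norm_num
  have h2 : ∀ x, (‖v x‖ₑ ^ (3 / 2 : ℝ)) ^ (4 : ℝ) = ‖v x‖ₑ ^ (6 : ℝ) := by
    intro x
    rw [← ENNReal.rpow_mul]; norm_num
  simp only [hprod, h1, h2] at hH
  -- the `L⁶` factor by Sobolev
  have hS := eLpNorm_six_le_frobenius_of_hasWeakGradient (F' := (EuclideanSpace ℝ (Fin 3))) finrank_euclideanSpace_fin hmem
    (hasWeakGradient_fderiv_of_contDiff hv)
  have h6 : ∫⁻ x, ‖v x‖ₑ ^ (6 : ℝ) = eLpNorm v 6 volume ^ (6 : ℝ) := by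
    rw [eLpNorm_eq_lintegral_rpow_enorm_toReal (by norm_num) (by norm_num)]
    rw [← ENNReal.rpow_mul]
    norm_num
  have hexp : (1 / (4 / 3 : ℝ)) = 3 / 4 := by norm_num
  rw [hexp] at hH
  have hA' : (∫⁻ x, ‖v x‖ₑ ^ 2) ^ (3 / 4 : ℝ) ≤ A ^ (3 / 4 : ℝ) := ENNReal.rpow_le_rpow hA (by norm_num)
  have h6' : (∫⁻ x, ‖v x‖ₑ ^ (6 : ℝ)) ^ (1 / (4 : ℝ)) ≤ ((K * D ^ (1 / 2 : ℝ)) ^ (6 : ℝ)) ^ (1 / (4 : ℝ)) := by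
    rw [h6]
    exact ENNReal.rpow_le_rpow (ENNReal.rpow_le_rpow hS (by norm_num)) (by norm_num)
  have hKD : ((K * D ^ (1 / 2 : ℝ)) ^ (6 : ℝ)) ^ (1 / (4 : ℝ)) = K ^ (3 / 2 : ℝ) * D ^ (3 / 4 : ℝ) := by
    rw [← ENNReal.rpow_mul, ENNReal.mul_rpow_of_nonneg _ _ (by norm_num), ← ENNReal.rpow_mul]
    norm_num
  calc ∫⁻ x, ‖v x‖ₑ ^ (3 : ℕ)
      ≤ (∫⁻ x, ‖v x‖ₑ ^ 2) ^ (3 / 4 : ℝ) * (∫⁻ x, ‖v x‖ₑ ^ (6 : ℝ)) ^ (1 / (4 : ℝ)) := hH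
    _ ≤ A ^ (3 / 4 : ℝ) * ((K * D ^ (1 / 2 : ℝ)) ^ (6 : ℝ)) ^ (1 / (4 : ℝ)) := mul_le_mul' hA' h6'
    _ = A ^ (3 / 4 : ℝ) * (K ^ (3 / 2 : ℝ) * D ^ (3 / 4 : ℝ)) := by rw [hKD]

/-- `D^{3/4} ≤ 1 + D` in `ℝ≥0∞`. [folklore] -/
theorem ENNReal.rpow_three_quarters_le_one_add (D : ℝ≥0∞) : D ^ (3 / 4 : ℝ) ≤ 1 + D := by
  rcases le_total D 1 with h | h
  · exact (ENNReal.rpow_le_one h (by norm_num)).trans le_self_add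
  · calc D ^ (3 / 4 : ℝ) ≤ D ^ (1 : ℝ) := ENNReal.rpow_le_rpow_of_exponent_le h (by norm_num)
      _ = D := ENNReal.rpow_one D
      _ ≤ 1 + D := le_add_self

variable {T ν : ℝ} {u : ℝ → (EuclideanSpace ℝ (Fin 3)) → (EuclideanSpace ℝ (Fin 3))} {p : ℝ → (EuclideanSpace ℝ (Fin 3)) → ℝ}

/-- **`u ∈ L³_{t,x}` for finite energy classical solutions with `∇u ∈ L²_{t,x}`**: integrating
the slice bound, `∫₀ᵀ∫|u|³ ≤ A^{3/4}K^{3/2}(T + ∫₀ᵀ∫|∇u|²) < ⊤`. [folklore] -/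
theorem IsClassicalNSSolutionOn.lintegral_enorm_pow_three_lt_top
    (h : IsClassicalNSSolutionOn (Icc 0 T) ν 0 u p) {A : ℝ≥0∞} (hAt : A ≠ ⊤)
    (hA : ∀ t ∈ Icc 0 T, ∫⁻ x, ‖u t x‖ₑ ^ 2 ≤ A)
    (hgrad : ∫⁻ τ in Ioo 0 T, ∫⁻ x, ENNReal.ofReal (frobeniusNormSq (fderiv ℝ (u τ) x)) < ⊤) :
    ∫⁻ τ in Ioo 0 T, ∫⁻ x, ‖u τ x‖ₑ ^ (3 : ℕ) < ⊤ := by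
  set K : ℝ≥0∞ := (SNormLESNormFDerivOfEqConst (EuclideanSpace ℝ (Fin 3)) (volume : Measure (EuclideanSpace ℝ (Fin 3))) 2 : ℝ≥0∞) with hK
  set c : ℝ≥0∞ := A ^ (3 / 4 : ℝ) * K ^ (3 / 2 : ℝ) with hc
  have hct : c ≠ ⊤ := ENNReal.mul_ne_top (ENNReal.rpow_ne_top_of_nonneg (by norm_num) hAt)
    (ENNReal.rpow_ne_top_of_nonneg (by norm_num) ENNReal.coe_ne_top)
  have hslice : ∀ τ ∈ Ioo 0 T, ∫⁻ x, ‖u τ x‖ₑ ^ (3 : ℕ) ≤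
      c * (1 + ∫⁻ x, ENNReal.ofReal (frobeniusNormSq (fderiv ℝ (u τ) x))) := by
    intro τ hτ
    have hv : ContDiff ℝ 1 (u τ) := (h.contDiff_velocity (Ioo_subset_Icc_self hτ)).of_le (by norm_cast)
    refine (lintegral_enorm_pow_three_le hv (hA τ (Ioo_subset_Icc_self hτ)) hAt).trans ?_
    rw [hc, mul_assoc]
    gcongr
    exact ENNReal.rpow_three_quarters_le_one_add _
  calc ∫⁻ τ in Ioo 0 T, ∫⁻ x, ‖u τ x‖ₑ ^ (3 : ℕ)
      ≤ ∫⁻ τ in Ioo 0 T, c * (1 + ∫⁻ x, ENNReal.ofReal (frobeniusNormSq (fderiv ℝ (u τ) x))) :=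
        setLIntegral_mono' measurableSet_Ioo hslice
    _ = c * (volume (Ioo 0 T) + ∫⁻ τ in Ioo 0 T, ∫⁻ x, ENNReal.ofReal (frobeniusNormSq (fderiv ℝ (u τ) x))) := by
        rw [lintegral_const_mul' _ _ hct, lintegral_add_left measurable_const, setLIntegral_const, one_mul]
    _ < ⊤ := by
        refine ENNReal.mul_lt_top hct.lt_top (ENNReal.add_lt_top.2 ⟨?_, hgrad⟩)
        rw [Real.volume_Ioo]; exact ENNReal.ofReal_lt_top

end Slices


/-! ## The energy equality for finite energy classical solutions -/

section Energy

open scoped RealInnerProductSpace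

variable {T ν : ℝ} {u : ℝ → (EuclideanSpace ℝ (Fin 3)) → (EuclideanSpace ℝ (Fin 3))} {p : ℝ → (EuclideanSpace ℝ (Fin 3)) → ℝ}

/-- The one-parameter family of Tao cut-offs used in the limit `R → ∞`: `φ_n = θ_{4(n+1), n+1}⁸`,
equal to `1` on `B̄(0, 3(n+1))`, supported in `B̄(0, 4(n+1))`, with `|Dφ_n| ≤ 8C₁/(n+1)`. [folklore] -/
theorem taoCutoff_family :
    ∃ C : ℝ, 0 < C ∧ ∀ n : ℕ,
      ContDiff ℝ 1 (fun x : (EuclideanSpace ℝ (Fin 3)) => FluidPDE.taoCutoff (4 * ((n : ℝ) + 1)) ((n : ℝ) + 1) x ^ 8) ∧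
      HasCompactSupport (fun x : (EuclideanSpace ℝ (Fin 3)) => FluidPDE.taoCutoff (4 * ((n : ℝ) + 1)) ((n : ℝ) + 1) x ^ 8) ∧
      (∀ x : (EuclideanSpace ℝ (Fin 3)), |FluidPDE.taoCutoff (4 * ((n : ℝ) + 1)) ((n : ℝ) + 1) x ^ 8| ≤ 1) ∧
      (∀ x : (EuclideanSpace ℝ (Fin 3)), ‖x‖ ≤ 3 * ((n : ℝ) + 1) → FluidPDE.taoCutoff (4 * ((n : ℝ) + 1)) ((n : ℝ) + 1) x ^ 8 = 1) ∧
      (∀ (x v : (EuclideanSpace ℝ (Fin 3))), |fderiv ℝ (fun y : (EuclideanSpace ℝ (Fin 3)) => FluidPDE.taoCutoff (4 * ((n : ℝ) + 1)) ((n : ℝ) + 1) y ^ 8) x v| ≤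
        C / ((n : ℝ) + 1) * ‖v‖) := by
  obtain ⟨C₁, hC₁, hC⟩ := FluidPDE.exists_norm_fderiv_taoCutoff_le (E := (EuclideanSpace ℝ (Fin 3)))
  refine ⟨8 * C₁, by positivity, fun n => ⟨FluidPDE.contDiff_taoCutoff_pow _ _ 8, ?_, ?_, ?_, ?_⟩⟩
  · exact FluidPDE.hasCompactSupport_taoCutoff_pow (by positivity) (by positivity) (by norm_num)
  · intro x
    rw [abs_of_nonneg (FluidPDE.taoCutoff_pow_nonneg _ _ x 8)]
    exact FluidPDE.taoCutoff_pow_le_one _ _ x 8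
  · intro x hx
    rw [FluidPDE.taoCutoff_eq_one_of_norm_le (by positivity) (by positivity) (by linarith) (by linarith), one_pow]
  · intro x v
    have hr : (0 : ℝ) < (n : ℝ) + 1 := by positivity
    have h8 := FluidPDE.abs_fderiv_taoCutoff_pow_eight_apply_le
      (hC (4 * ((n : ℝ) + 1)) ((n : ℝ) + 1) hr (by positivity)) x v
    refine h8.trans ?_
    have hθ : FluidPDE.taoCutoff (4 * ((n : ℝ) + 1)) ((n : ℝ) + 1) x ^ 7 ≤ 1 := FluidPDE.taoCutoff_pow_le_one _ _ x 7
    have hθ0 : 0 ≤ FluidPDE.taoCutoff (4 * ((n : ℝ) + 1)) ((n : ℝ) + 1) x ^ 7 := FluidPDE.taoCutoff_pow_nonneg _ _ x 7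
    have hc0 : 0 ≤ C₁ / ((n : ℝ) + 1) := by positivity
    calc 8 * FluidPDE.taoCutoff (4 * ((n : ℝ) + 1)) ((n : ℝ) + 1) x ^ 7 * (C₁ / ((n : ℝ) + 1)) * ‖v‖
        ≤ 8 * 1 * (C₁ / ((n : ℝ) + 1)) * ‖v‖ := by gcongr
      _ = 8 * C₁ / ((n : ℝ) + 1) * ‖v‖ := by ring

/-- **The pressure slice identity** ((54): the constant drops against a divergence-free field):
if `q = p̃[v] + c` then `∫ q Dφ(v) = ∫ p̃[v] Dφ(v)` for compactly supported `C¹` weights `φ`. [cite: Tao2011, §8, proof of Lemma 8.1, (54)] -/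
theorem integral_pressure_shift_eq {v : (EuclideanSpace ℝ (Fin 3)) → (EuclideanSpace ℝ (Fin 3))} (hv : ContDiff ℝ 1 v) (hdiv : VectorCalculus.IsDivFree v)
    {φ : (EuclideanSpace ℝ (Fin 3)) → ℝ} (hφ : ContDiff ℝ 1 φ) (hφc : HasCompactSupport φ)
    {q : (EuclideanSpace ℝ (Fin 3)) → ℝ} (hq : Continuous q) {c : ℝ} (hqc : ∀ x, q x = FluidPDE.normalisedPressure v x + c) :
    ∫ x, q x * fderiv ℝ φ x (v x) = ∫ x, FluidPDE.normalisedPressure v x * fderiv ℝ φ x (v x) := by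
  have hvc : Continuous v := hv.continuous
  have hD : Continuous fun x => fderiv ℝ φ x (v x) :=
    (hφ.continuous_fderiv one_ne_zero).clm_apply hvc
  have hDc : HasCompactSupport fun x => fderiv ℝ φ x (v x) := by
    refine (hφc.fderiv ℝ).mono fun x hx => ?_
    rw [Function.mem_support] at hx ⊢
    contrapose! hx
    rw [hx]
    rfl
  have i1 : Integrable fun x => q x * fderiv ℝ φ x (v x) :=
    (hq.mul hD).integrable_of_hasCompactSupport hDc.mul_left
  have i2 : Integrable fun x => c * fderiv ℝ φ x (v x) :=
    (continuous_const.mul hD).integrable_of_hasCompactSupport hDc.mul_left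
  have : (fun x => FluidPDE.normalisedPressure v x * fderiv ℝ φ x (v x)) =
      fun x => q x * fderiv ℝ φ x (v x) - c * fderiv ℝ φ x (v x) := by
    funext x
    rw [hqc x]
    ring
  rw [this, integral_sub i1 i2, integral_const_mul,
    FluidPDE.integral_fderiv_apply_eq_zero_of_isDivFree hv hdiv hφ hφc, mul_zero, sub_zero]

/-- `∫ φ |∇v|²` is dominated by the full dissipation, in `ℝ≥0∞`. [folklore] -/
theorem ofReal_localisedDissipation_le {v : (EuclideanSpace ℝ (Fin 3)) → (EuclideanSpace ℝ (Fin 3))} (hv : ContDiff ℝ 1 v) {φ : (EuclideanSpace ℝ (Fin 3)) → ℝ}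
    (hφ : Continuous φ) (hφc : HasCompactSupport φ) (hφ0 : ∀ x, 0 ≤ φ x) (hφ1 : ∀ x, φ x ≤ 1) :
    ENNReal.ofReal (FluidPDE.localisedDissipation φ v) ≤
      ∫⁻ x, ENNReal.ofReal (frobeniusNormSq (fderiv ℝ v x)) := by
  have hc : Continuous fun x => frobeniusNormSq (fderiv ℝ v x) :=
    LerayHopfProofs.continuous_frobeniusNormSq.comp (hv.continuous_fderiv one_ne_zero)
  have hi : Integrable fun x => φ x * frobeniusNormSq (fderiv ℝ v x) :=
    (hφ.mul hc).integrable_of_hasCompactSupport hφc.mul_right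
  rw [FluidPDE.localisedDissipation, ofReal_integral_eq_lintegral_ofReal hi
    (Eventually.of_forall fun x => mul_nonneg (hφ0 x) (frobeniusNormSq_nonneg _))]
  refine lintegral_mono fun x => ENNReal.ofReal_le_ofReal ?_
  exact (mul_le_of_le_one_left (frobeniusNormSq_nonneg _) (hφ1 x))

/-- **The energy equality for finite energy classical solutions** (Tao 2011, Lemma 8.1, sharp
form; Leray 1934, (3.4)). Let `(u, p)` be a classical solution of the unforced system on
`[0, T] × ℝ³` with `sup_t ∫|u(t)|² ≤ A < ⊤`, `∇u ∈ L²_{t,x}` and `u ∈ L³_{t,x}` (both automatic,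
see `isLerayHopfOn_of_finiteEnergy`). Then for `0 ≤ s ≤ t ≤ T`,
`½‖u(t)‖₂² + ν∫ₛᵗ∫|∇u|² = ½‖u(s)‖₂²`. Proof: the localised energy balance of the tree
(`energy_balance_cutoff`) against `φ_n = θ⁸_{4(n+1),n+1}` and `n → ∞`; the transported energy and
the viscous cross term are `O(1/n)` by the `L³` and `L²` bounds exactly as in
`IsClassicalNSSolutionOn.energyEq`; the pressure term is handled by Tao's Lemma 4.1 (i)
(`p(τ) = p̃[u(τ)] + C(τ)` for a.e. `τ`, the constant dropping out against the divergence-free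
`u`) and the estimate of `X₅` (`tao2011_pressureTerm_estimate`):
`|∫ p̃ Dφ_n(u)| ≤ ε∫|∇u(τ)|² + C₅(εA/r_n² + A³/(ε³r_n⁴))` for every `ε > 0`, whence the pressure
contribution tends to `0`. [cite: Tao2011, Lemma 8.1 (proof, §8, (54), (61)–(65))] -/
theorem IsClassicalNSSolutionOn.energyEq_of_finiteEnergy (hP : FluidPDE.tao_pressure_normalisation)
    (hX5 : FluidPDE.tao2011_pressureTerm_estimate)
    (h : IsClassicalNSSolutionOn (Icc 0 T) ν 0 u p) (hν : 0 < ν) (hT : 0 < T)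
    {A : ℝ≥0∞} (hAt : A ≠ ⊤) (hA : ∀ t ∈ Icc 0 T, ∫⁻ x, ‖u t x‖ₑ ^ 2 ≤ A)
    (hgrad : ∫⁻ τ in Ioo 0 T, ∫⁻ x, ENNReal.ofReal (frobeniusNormSq (fderiv ℝ (u τ) x)) < ⊤)
    (hu₃ : ∫⁻ τ in Ioo 0 T, ∫⁻ x, ‖u τ x‖ₑ ^ (3 : ℕ) < ⊤)
    {s t : ℝ} (hs : 0 ≤ s) (hst : s ≤ t) (ht : t ≤ T) :
    VectorCalculus.kineticEnergy (u t) +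
      ν * (∫⁻ τ in Ioo s t, ∫⁻ x, ENNReal.ofReal (frobeniusNormSq (fderiv ℝ (u τ) x))).toReal =
      VectorCalculus.kineticEnergy (u s) := by
  set b := stdOrthonormalBasis ℝ (EuclideanSpace ℝ (Fin 3))
  have hU : UniqueDiffOn ℝ (Icc 0 T) := uniqueDiffOn_Icc hT
  have htI : t ∈ Icc 0 T := ⟨hs.trans hst, ht⟩
  have hsI : s ∈ Icc 0 T := ⟨hs, hst.trans ht⟩
  have hIcc : ∀ {τ}, τ ∈ Ioo s t → τ ∈ Icc 0 T := fun hτ => ⟨hs.trans hτ.1.le, hτ.2.le.trans ht⟩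
  have hmem : ∀ τ ∈ Icc 0 T, MemLp (u τ) 2 volume := fun τ hτ =>
    memLp_two_of_lintegral_lt_top (h.contDiff_velocity hτ).continuous ((hA τ hτ).trans_lt hAt.lt_top)
  have hM : ∀ τ ∈ Icc 0 T, eEnergy (u τ) ≤ A := fun τ hτ => hA τ hτ
  -- joint continuity on `[s, t] × E`
  have hsub : Icc s t ×ˢ (univ : Set (EuclideanSpace ℝ (Fin 3))) ⊆ Icc 0 T ×ˢ univ :=
    prod_mono (Icc_subset_Icc hs ht) Subset.rfl
  have cu : ContinuousOn (fun z : ℝ × (EuclideanSpace ℝ (Fin 3)) => u z.1 z.2) (Icc s t ×ˢ univ) :=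
    h.smooth_velocity.continuousOn.mono hsub
  have cDu : ContinuousOn (fun z : ℝ × (EuclideanSpace ℝ (Fin 3)) => fderiv ℝ (u z.1) z.2) (Icc s t ×ˢ univ) :=
    (h.smooth_velocity.fderiv_slice hU).continuousOn.mono hsub
  -- the cut-offs
  obtain ⟨C, hC0', hfam⟩ := taoCutoff_family
  have hC0 : 0 ≤ C := hC0'.le
  have hRpos : ∀ n : ℕ, (0 : ℝ) < n + 1 := fun n => Nat.cast_add_one_pos n
  set φ : ℕ → (EuclideanSpace ℝ (Fin 3)) → ℝ := fun n x => FluidPDE.taoCutoff (4 * ((n : ℝ) + 1)) ((n : ℝ) + 1) x ^ 8 with hφdef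
  have hφ1 : ∀ n, ContDiff ℝ 1 (φ n) := fun n => (hfam n).1
  have hφc : ∀ n, HasCompactSupport (φ n) := fun n => (hfam n).2.1
  have hφle : ∀ n x, |φ n x| ≤ 1 := fun n => (hfam n).2.2.1
  have hφlim : ∀ x, Tendsto (fun n => φ n x) atTop (𝓝 1) := by
    intro x
    obtain ⟨N, hN⟩ := exists_nat_ge (‖x‖ / 3)
    refine tendsto_atTop_of_eventually_const (i₀ := N) fun n hn => ?_
    refine (hfam n).2.2.2.1 x ?_
    have : (N : ℝ) ≤ n := by exact_mod_cast hn
    rw [div_le_iff₀ (by norm_num : (0 : ℝ) < 3)] at hN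
    linarith
  have hDφv : ∀ n x v, |fderiv ℝ (φ n) x v| ≤ C / ((n : ℝ) + 1) * ‖v‖ := fun n => (hfam n).2.2.2.2
  have hc' : ∀ n : ℕ, (0 : ℝ) ≤ C / ((n : ℝ) + 1) := fun n => div_nonneg hC0 (hRpos n).le
  have hrate : ∀ K : ℝ, Tendsto (fun n : ℕ => K * (1 / ((n : ℝ) + 1))) atTop (𝓝 0) := fun K => by
    simpa using (tendsto_one_div_add_atTop_nhds_zero_nat (𝕜 := ℝ)).const_mul K
  -- the identity for each `n`
  have hid := fun n => h.energy_balance_cutoff hT (hφ1 n) (hφc n) hs hst ht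
  -- (a) the kinetic terms
  have limE : ∀ {r}, r ∈ Icc 0 T →
      Tendsto (fun n => 2⁻¹ * ∫ x, φ n x * ‖u r x‖ ^ 2) atTop (𝓝 (VectorCalculus.kineticEnergy (u r))) := by
    intro r hr
    have hur : Continuous (u r) := (h.contDiff_velocity hr).continuous
    refine Tendsto.const_mul _ (tendsto_integral_of_dominated_convergence (fun x => ‖u r x‖ ^ 2)
      ?_ ((hmem r hr).integrable_norm_pow two_ne_zero) ?_ ?_)
    · exact fun n => ((hφ1 n).continuous.mul (hur.norm.pow 2)).aestronglyMeasurable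
    · refine fun n => Eventually.of_forall fun x => ?_
      rw [Real.norm_eq_abs, abs_mul, abs_of_nonneg (sq_nonneg ‖u r x‖)]
      exact mul_le_of_le_one_left (sq_nonneg _) (hφle n x)
    · exact Eventually.of_forall fun x => by simpa using (hφlim x).mul_const (‖u r x‖ ^ 2)
  -- (b) the transported kinetic energy `½ ∫∫ (Dφ·u)|u|²` is `O(1/n)`
  have lim1 : Tendsto (fun n => ∫ τ in Ioo s t, ∫ x, fderiv ℝ (φ n) x (u τ x) * ‖u τ x‖ ^ 2)
      atTop (𝓝 0) := by
    set L := ∫⁻ τ in Ioo 0 T, ∫⁻ x, ‖u τ x‖ₑ ^ (3 : ℕ) with hL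
    have hLt : L ≠ ⊤ := hu₃.ne
    refine squeeze_zero_norm (a := fun n : ℕ => C * L.toReal * (1 / ((n : ℝ) + 1)))
      (fun n => ?_) (hrate _)
    have hpt : ∀ τ x, ‖fderiv ℝ (φ n) x (u τ x) * ‖u τ x‖ ^ 2‖ₑ ≤
        ENNReal.ofReal (C / ((n : ℝ) + 1)) * ‖u τ x‖ₑ ^ (3 : ℕ) := fun τ x => by
      rw [Real.enorm_eq_ofReal_abs, ← ofReal_norm, ← ENNReal.ofReal_pow (norm_nonneg _),
        ← ENNReal.ofReal_mul (hc' n)]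
      refine ENNReal.ofReal_le_ofReal ?_
      rw [abs_mul, abs_of_nonneg (sq_nonneg ‖u τ x‖)]
      calc |fderiv ℝ (φ n) x (u τ x)| * ‖u τ x‖ ^ 2
          ≤ C / ((n : ℝ) + 1) * ‖u τ x‖ * ‖u τ x‖ ^ 2 := by gcongr; exact hDφv n x _
        _ = C / ((n : ℝ) + 1) * ‖u τ x‖ ^ 3 := by ring
    have hle : ∫⁻ τ in Ioo s t, ∫⁻ x, ‖fderiv ℝ (φ n) x (u τ x) * ‖u τ x‖ ^ 2‖ₑ ≤
        ENNReal.ofReal (C / ((n : ℝ) + 1)) * L := by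
      calc ∫⁻ τ in Ioo s t, ∫⁻ x, ‖fderiv ℝ (φ n) x (u τ x) * ‖u τ x‖ ^ 2‖ₑ
          ≤ ∫⁻ τ in Ioo s t, ∫⁻ x, ENNReal.ofReal (C / ((n : ℝ) + 1)) * ‖u τ x‖ₑ ^ (3 : ℕ) :=
            lintegral_mono fun τ => lintegral_mono fun x => hpt τ x
        _ = ENNReal.ofReal (C / ((n : ℝ) + 1)) * ∫⁻ τ in Ioo s t, ∫⁻ x, ‖u τ x‖ₑ ^ (3 : ℕ) := by
            simp only [lintegral_const_mul' _ _ ENNReal.ofReal_ne_top]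
        _ ≤ ENNReal.ofReal (C / ((n : ℝ) + 1)) * L :=
            mul_le_mul_right (lintegral_Ioo_mono hs ht) _
    refine (norm_integral_integral_le_of_lintegral_le
      (G := fun z : ℝ × (EuclideanSpace ℝ (Fin 3)) => fderiv ℝ (φ n) z.2 (u z.1 z.2) * ‖u z.1 z.2‖ ^ 2)
      (ENNReal.mul_ne_top ENNReal.ofReal_ne_top hLt) hle).trans_eq ?_
    rw [ENNReal.toReal_mul, ENNReal.toReal_ofReal (hc' n)]
    ring
  -- (c) the viscous cross term `ν ∫∫ Σᵢ ∂ᵢφ ⟪∂ᵢu, u⟫` is `O(1/n)` (Young's inequality)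
  have lim3 : Tendsto (fun n => ∫ τ in Ioo s t, ∫ x, ∑ i, fderiv ℝ (φ n) x (b i) *
      ⟪fderiv ℝ (u τ) x (b i), u τ x⟫) atTop (𝓝 0) := by
    set Lg := ∫⁻ τ in Ioo 0 T, ∫⁻ x, ENNReal.ofReal (frobeniusNormSq (fderiv ℝ (u τ) x)) with hLg
    set d : ℕ := (Finset.univ : Finset (Fin (Module.finrank ℝ (EuclideanSpace ℝ (Fin 3))))).card with hd
    set B : ℝ≥0∞ := Lg + (d : ℝ≥0∞) * A * ENNReal.ofReal T with hB
    have hBt : B ≠ ⊤ := ENNReal.add_ne_top.2 ⟨hgrad.ne, ENNReal.mul_ne_top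
      (ENNReal.mul_ne_top (ENNReal.natCast_ne_top d) hAt) ENNReal.ofReal_ne_top⟩
    refine squeeze_zero_norm (a := fun n : ℕ => C * B.toReal * (1 / ((n : ℝ) + 1)))
      (fun n => ?_) (hrate _)
    -- pointwise Young bound
    have hpt : ∀ τ x, ‖∑ i, fderiv ℝ (φ n) x (b i) * ⟪fderiv ℝ (u τ) x (b i), u τ x⟫‖ₑ ≤
        ENNReal.ofReal (C / ((n : ℝ) + 1)) *
          (ENNReal.ofReal (frobeniusNormSq (fderiv ℝ (u τ) x)) + d * ‖u τ x‖ₑ ^ 2) := by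
      intro τ x
      have hreal : |∑ i, fderiv ℝ (φ n) x (b i) * ⟪fderiv ℝ (u τ) x (b i), u τ x⟫| ≤
          C / ((n : ℝ) + 1) * (frobeniusNormSq (fderiv ℝ (u τ) x) + d * ‖u τ x‖ ^ 2) := by
        calc |∑ i, fderiv ℝ (φ n) x (b i) * ⟪fderiv ℝ (u τ) x (b i), u τ x⟫|
            ≤ ∑ i, |fderiv ℝ (φ n) x (b i) * ⟪fderiv ℝ (u τ) x (b i), u τ x⟫| :=
              Finset.abs_sum_le_sum_abs _ _
          _ ≤ ∑ i, C / ((n : ℝ) + 1) * (‖fderiv ℝ (u τ) x (b i)‖ ^ 2 + ‖u τ x‖ ^ 2) := by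
              refine Finset.sum_le_sum fun i _ => ?_
              rw [abs_mul]
              have h1 : |fderiv ℝ (φ n) x (b i)| ≤ C / ((n : ℝ) + 1) := by
                simpa [b.orthonormal.1 i] using hDφv n x (b i)
              have h2 : |⟪fderiv ℝ (u τ) x (b i), u τ x⟫| ≤
                  ‖fderiv ℝ (u τ) x (b i)‖ ^ 2 + ‖u τ x‖ ^ 2 :=
                (abs_real_inner_le_norm _ _).trans (by
                  nlinarith [sq_nonneg (‖fderiv ℝ (u τ) x (b i)‖ - ‖u τ x‖),
                    norm_nonneg (fderiv ℝ (u τ) x (b i)), norm_nonneg (u τ x)])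
              exact mul_le_mul h1 h2 (abs_nonneg _) (hc' n)
          _ = C / ((n : ℝ) + 1) * (frobeniusNormSq (fderiv ℝ (u τ) x) + d * ‖u τ x‖ ^ 2) := by
              rw [← Finset.mul_sum, Finset.sum_add_distrib, Finset.sum_const, nsmul_eq_mul,
                frobeniusNormSq_eq_sum b]
      rw [Real.enorm_eq_ofReal_abs]
      refine (ENNReal.ofReal_le_ofReal hreal).trans_eq ?_
      rw [ENNReal.ofReal_mul (hc' n), ENNReal.ofReal_add (frobeniusNormSq_nonneg _) (by positivity),
        ENNReal.ofReal_mul (Nat.cast_nonneg _), ENNReal.ofReal_natCast, ← ofReal_norm,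
        ← ENNReal.ofReal_pow (norm_nonneg _)]
    -- inner integrals, `τ ∈ (s, t)`
    have hin : ∀ τ ∈ Ioo s t,
        ∫⁻ x, ‖∑ i, fderiv ℝ (φ n) x (b i) * ⟪fderiv ℝ (u τ) x (b i), u τ x⟫‖ₑ ≤
          ENNReal.ofReal (C / ((n : ℝ) + 1)) *
            ((∫⁻ x, ENNReal.ofReal (frobeniusNormSq (fderiv ℝ (u τ) x))) + d * A) := by
      intro τ hτ
      have hτI := hIcc hτ
      have hmeas : AEMeasurable (fun x => ENNReal.ofReal (frobeniusNormSq (fderiv ℝ (u τ) x)))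
          (volume : Measure (EuclideanSpace ℝ (Fin 3))) :=
        (ENNReal.continuous_ofReal.comp (LerayHopfProofs.continuous_frobeniusNormSq.comp
          ((h.contDiff_velocity hτI).continuous_fderiv (by simp)))).aemeasurable
      calc ∫⁻ x, ‖∑ i, fderiv ℝ (φ n) x (b i) * ⟪fderiv ℝ (u τ) x (b i), u τ x⟫‖ₑ
          ≤ ∫⁻ x, ENNReal.ofReal (C / ((n : ℝ) + 1)) *
              (ENNReal.ofReal (frobeniusNormSq (fderiv ℝ (u τ) x)) + d * ‖u τ x‖ₑ ^ 2) :=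
            lintegral_mono fun x => hpt τ x
        _ = ENNReal.ofReal (C / ((n : ℝ) + 1)) *
              ((∫⁻ x, ENNReal.ofReal (frobeniusNormSq (fderiv ℝ (u τ) x))) +
                d * ∫⁻ x, ‖u τ x‖ₑ ^ 2) := by
            rw [lintegral_const_mul' _ _ ENNReal.ofReal_ne_top, lintegral_add_left' hmeas,
              lintegral_const_mul' _ _ (ENNReal.natCast_ne_top d)]
        _ ≤ ENNReal.ofReal (C / ((n : ℝ) + 1)) *
              ((∫⁻ x, ENNReal.ofReal (frobeniusNormSq (fderiv ℝ (u τ) x))) + d * A) := by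
            gcongr
            exact hM τ hτI
    have hle : ∫⁻ τ in Ioo s t,
        ∫⁻ x, ‖∑ i, fderiv ℝ (φ n) x (b i) * ⟪fderiv ℝ (u τ) x (b i), u τ x⟫‖ₑ ≤
          ENNReal.ofReal (C / ((n : ℝ) + 1)) * B := by
      calc ∫⁻ τ in Ioo s t, ∫⁻ x, ‖∑ i, fderiv ℝ (φ n) x (b i) * ⟪fderiv ℝ (u τ) x (b i), u τ x⟫‖ₑ
          ≤ ∫⁻ τ in Ioo s t, ENNReal.ofReal (C / ((n : ℝ) + 1)) *
              ((∫⁻ x, ENNReal.ofReal (frobeniusNormSq (fderiv ℝ (u τ) x))) + d * A) :=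
            setLIntegral_mono' measurableSet_Ioo hin
        _ = ENNReal.ofReal (C / ((n : ℝ) + 1)) *
              ((∫⁻ τ in Ioo s t, ∫⁻ x, ENNReal.ofReal (frobeniusNormSq (fderiv ℝ (u τ) x))) +
                d * A * volume (Ioo s t)) := by
            rw [lintegral_const_mul' _ _ ENNReal.ofReal_ne_top, lintegral_add_right _ measurable_const,
              setLIntegral_const]
        _ ≤ ENNReal.ofReal (C / ((n : ℝ) + 1)) * B := by
            rw [hB, Real.volume_Ioo]
            gcongr
            · exact lintegral_Ioo_mono hs ht
            · linarith
    refine (norm_integral_integral_le_of_lintegral_le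
      (G := fun z : ℝ × (EuclideanSpace ℝ (Fin 3)) => ∑ i, fderiv ℝ (φ n) z.2 (b i) * ⟪fderiv ℝ (u z.1) z.2 (b i), u z.1 z.2⟫)
      (ENNReal.mul_ne_top ENNReal.ofReal_ne_top hBt) hle).trans_eq ?_
    rw [ENNReal.toReal_mul, ENNReal.toReal_ofReal (hc' n)]
    ring
  -- (d) the pressure flux `∫∫ p (Dφ·u)`: Lemma 4.1 (i) and the estimate of `X₅`
  have lim4 : Tendsto (fun n => ∫ τ in Ioo s t, ∫ x, p τ x * fderiv ℝ (φ n) x (u τ x))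
      atTop (𝓝 0) := by
    obtain ⟨Cf, -, -, hae⟩ := hP ν T hν hT u p h ⟨A, hAt.lt_top, hA⟩
    obtain ⟨C₅, hC₅0, h5⟩ := hX5
    set Ar : ℝ := Real.sqrt A.toReal with hAr
    have hAr0 : 0 ≤ Ar := Real.sqrt_nonneg _
    have hAr2 : ENNReal.ofReal (Ar ^ 2) = A := by
      rw [hAr, Real.sq_sqrt ENNReal.toReal_nonneg, ENNReal.ofReal_toReal hAt]
    set G : ℝ → ℝ≥0∞ := fun τ => ∫⁻ x, ENNReal.ofReal (frobeniusNormSq (fderiv ℝ (u τ) x)) with hG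
    set Dst : ℝ≥0∞ := ∫⁻ τ in Ioo s t, G τ with hDst
    have hDst : Dst ≠ ⊤ := ((lintegral_Ioo_mono hs ht).trans_lt hgrad).ne
    -- the slice bound, for a.e. `τ ∈ (s, t)` and every `ε > 0`, `n`
    have hae' : ∀ᵐ τ ∂(volume.restrict (Ioo s t)), ∀ x, p τ x = FluidPDE.normalisedPressure (u τ) x + Cf τ :=
      ae_restrict_of_ae_restrict_of_subset (Ioo_subset_Icc_self.trans (Icc_subset_Icc hs ht)) hae
    have hslice : ∀ {ε : ℝ} (hε : 0 < ε) (n : ℕ), ∀ᵐ τ ∂(volume.restrict (Ioo s t)),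
        ‖∫ x, p τ x * fderiv ℝ (φ n) x (u τ x)‖ₑ ≤
          ENNReal.ofReal ε * G τ +
            ENNReal.ofReal (C₅ * (ε * Ar ^ 2 / ((n : ℝ) + 1) ^ 2 + Ar ^ 6 / (ε ^ 3 * ((n : ℝ) + 1) ^ 4))) := by
      intro ε hε n
      filter_upwards [hae', ae_restrict_mem measurableSet_Ioo] with τ hτ hτm
      have hτI := hIcc hτm
      have hv := h.contDiff_velocity hτI
      have hv1 : ContDiff ℝ 1 (u τ) := hv.of_le (by norm_cast)
      have heq := integral_pressure_shift_eq hv1 (h.divFree τ hτI) (hφ1 n) (hφc n)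
        (h.contDiff_pressure hτI).continuous hτ
      have hr : (0 : ℝ) < (n : ℝ) + 1 := hRpos n
      have h5' := h5 (u τ) hv Ar hAr0 (by rw [hAr2]; exact hA τ hτI) (4 * ((n : ℝ) + 1)) ((n : ℝ) + 1)
        hr (by linarith) ε hε
      have h5'' : |∫ x, FluidPDE.normalisedPressure (u τ) x * fderiv ℝ (φ n) x (u τ x)| ≤
          ε * FluidPDE.localisedDissipation (φ n) (u τ) +
            C₅ * (ε * Ar ^ 2 / ((n : ℝ) + 1) ^ 2 + Ar ^ 6 / (ε ^ 3 * ((n : ℝ) + 1) ^ 4)) := h5'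
      rw [← heq] at h5''
      have hX : ENNReal.ofReal (FluidPDE.localisedDissipation (φ n) (u τ)) ≤ G τ :=
        ofReal_localisedDissipation_le hv1 (hφ1 n).continuous (hφc n)
          (fun x => FluidPDE.taoCutoff_pow_nonneg _ _ x 8) (fun x => FluidPDE.taoCutoff_pow_le_one _ _ x 8)
      rw [Real.enorm_eq_ofReal_abs]
      refine (ENNReal.ofReal_le_ofReal h5'').trans ?_
      have hX0 : 0 ≤ ε * FluidPDE.localisedDissipation (φ n) (u τ) :=
        mul_nonneg hε.le (FluidPDE.localisedDissipation_nonneg (fun x => FluidPDE.taoCutoff_pow_nonneg _ _ x 8) _)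
      rw [ENNReal.ofReal_add hX0 (by positivity), ENNReal.ofReal_mul hε.le]
      gcongr
    -- hence the bound on the time integral
    have hbound : ∀ {ε : ℝ} (hε : 0 < ε) (n : ℕ),
        |∫ τ in Ioo s t, ∫ x, p τ x * fderiv ℝ (φ n) x (u τ x)| ≤
          ε * Dst.toReal +
            C₅ * (ε * Ar ^ 2 / ((n : ℝ) + 1) ^ 2 + Ar ^ 6 / (ε ^ 3 * ((n : ℝ) + 1) ^ 4)) * (t - s) := by
      intro ε hε n
      set K₂ : ℝ := C₅ * (ε * Ar ^ 2 / ((n : ℝ) + 1) ^ 2 + Ar ^ 6 / (ε ^ 3 * ((n : ℝ) + 1) ^ 4)) with hK₂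
      have hK₂0 : 0 ≤ K₂ := by positivity
      have hle : ∫⁻ τ in Ioo s t, ‖∫ x, p τ x * fderiv ℝ (φ n) x (u τ x)‖ₑ ≤
          ENNReal.ofReal ε * Dst + ENNReal.ofReal K₂ * volume (Ioo s t) := by
        calc ∫⁻ τ in Ioo s t, ‖∫ x, p τ x * fderiv ℝ (φ n) x (u τ x)‖ₑ
            ≤ ∫⁻ τ in Ioo s t, (ENNReal.ofReal ε * G τ + ENNReal.ofReal K₂) := lintegral_mono_ae (hslice hε n)
          _ = ENNReal.ofReal ε * Dst + ENNReal.ofReal K₂ * volume (Ioo s t) := by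
              rw [lintegral_add_right _ measurable_const, lintegral_const_mul' _ _ ENNReal.ofReal_ne_top,
                setLIntegral_const]
      have hfin : ENNReal.ofReal ε * Dst + ENNReal.ofReal K₂ * volume (Ioo s t) ≠ ⊤ := by
        rw [Real.volume_Ioo]
        exact ENNReal.add_ne_top.2 ⟨ENNReal.mul_ne_top ENNReal.ofReal_ne_top hDst,
          ENNReal.mul_ne_top ENNReal.ofReal_ne_top ENNReal.ofReal_ne_top⟩
      have h1 : ‖∫ τ in Ioo s t, ∫ x, p τ x * fderiv ℝ (φ n) x (u τ x)‖ ≤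
          (ENNReal.ofReal ε * Dst + ENNReal.ofReal K₂ * volume (Ioo s t)).toReal := by
        refine (norm_integral_le_lintegral_norm _).trans (ENNReal.toReal_mono hfin ?_)
        refine le_trans (lintegral_mono fun τ => ?_) hle
        rw [ofReal_norm]
      rw [Real.norm_eq_abs] at h1
      refine h1.trans_eq ?_
      rw [Real.volume_Ioo, ENNReal.toReal_add (ENNReal.mul_ne_top ENNReal.ofReal_ne_top hDst)
        (ENNReal.mul_ne_top ENNReal.ofReal_ne_top ENNReal.ofReal_ne_top), ENNReal.toReal_mul,
        ENNReal.toReal_mul, ENNReal.toReal_ofReal hε.le, ENNReal.toReal_ofReal hK₂0,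
        ENNReal.toReal_ofReal (by linarith)]
    -- and the limit
    rw [Metric.tendsto_nhds]
    intro δ hδ
    set ε : ℝ := δ / (2 * (Dst.toReal + 1)) with hεdef
    have hD0 : 0 ≤ Dst.toReal := ENNReal.toReal_nonneg
    have hε : 0 < ε := by positivity
    have hεD : ε * Dst.toReal ≤ δ / 2 := by
      rw [hεdef, div_mul_eq_mul_div, div_le_iff₀ (by positivity)]
      nlinarith
    have hsecond : Tendsto (fun n : ℕ =>
        C₅ * (ε * Ar ^ 2 / ((n : ℝ) + 1) ^ 2 + Ar ^ 6 / (ε ^ 3 * ((n : ℝ) + 1) ^ 4)) * (t - s))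
        atTop (𝓝 0) := by
      have h0 : Tendsto (fun n : ℕ => (1 : ℝ) / ((n : ℝ) + 1)) atTop (𝓝 0) :=
        tendsto_one_div_add_atTop_nhds_zero_nat
      have e : ∀ n : ℕ, C₅ * (ε * Ar ^ 2 / ((n : ℝ) + 1) ^ 2 + Ar ^ 6 / (ε ^ 3 * ((n : ℝ) + 1) ^ 4)) * (t - s) =
          C₅ * (ε * Ar ^ 2 * (1 / ((n : ℝ) + 1)) ^ 2 + Ar ^ 6 / ε ^ 3 * (1 / ((n : ℝ) + 1)) ^ 4) *
            (t - s) := by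
        intro n
        have : (n : ℝ) + 1 ≠ 0 := (hRpos n).ne'
        field_simp
      simp_rw [e]
      have := ((((h0.pow 2).const_mul (ε * Ar ^ 2)).add ((h0.pow 4).const_mul (Ar ^ 6 / ε ^ 3))).const_mul
        C₅).mul_const (t - s)
      simpa using this
    have hev : ∀ᶠ n : ℕ in atTop,
        |C₅ * (ε * Ar ^ 2 / ((n : ℝ) + 1) ^ 2 + Ar ^ 6 / (ε ^ 3 * ((n : ℝ) + 1) ^ 4)) * (t - s)| < δ / 2 := by
      have h2 := hsecond
      rw [Metric.tendsto_nhds] at h2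
      simpa only [dist_zero_right, Real.norm_eq_abs] using h2 (δ / 2) (half_pos hδ)
    filter_upwards [hev] with n hn
    rw [dist_zero_right, Real.norm_eq_abs]
    calc |∫ τ in Ioo s t, ∫ x, p τ x * fderiv ℝ (φ n) x (u τ x)|
        ≤ ε * Dst.toReal +
            C₅ * (ε * Ar ^ 2 / ((n : ℝ) + 1) ^ 2 + Ar ^ 6 / (ε ^ 3 * ((n : ℝ) + 1) ^ 4)) * (t - s) :=
          hbound hε n
      _ < δ := by
          linarith [le_abs_self (C₅ * (ε * Ar ^ 2 / ((n : ℝ) + 1) ^ 2 +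
            Ar ^ 6 / (ε ^ 3 * ((n : ℝ) + 1) ^ 4)) * (t - s))]
  -- (e) the dissipation `ν ∫∫ φ |∇u|² → ν ∫∫ |∇u|²` (dominated convergence on `(s, t) × ℝ³`)
  set μ : Measure (ℝ × (EuclideanSpace ℝ (Fin 3))) := ((volume : Measure ℝ).restrict (Ioo s t)).prod (volume : Measure (EuclideanSpace ℝ (Fin 3)))
    with hμ
  have lim2 : Tendsto (fun n => ∫ τ in Ioo s t, ∫ x, φ n x * frobeniusNormSq (fderiv ℝ (u τ) x))
      atTop (𝓝 ((∫⁻ τ in Ioo s t, ∫⁻ x,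
        ENNReal.ofReal (frobeniusNormSq (fderiv ℝ (u τ) x))).toReal)) := by
    have cG : ContinuousOn (fun z : ℝ × (EuclideanSpace ℝ (Fin 3)) => frobeniusNormSq (fderiv ℝ (u z.1) z.2))
        (Icc s t ×ˢ univ) := LerayHopfProofs.continuous_frobeniusNormSq.comp_continuousOn cDu
    have hGi : Integrable (fun z : ℝ × (EuclideanSpace ℝ (Fin 3)) => frobeniusNormSq (fderiv ℝ (u z.1) z.2)) μ := by
      refine integrable_prod_of_continuousOn_of_lintegral cG ?_
      calc ∫⁻ τ in Ioo s t, ∫⁻ x, ‖frobeniusNormSq (fderiv ℝ (u τ) x)‖ₑ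
          = ∫⁻ τ in Ioo s t, ∫⁻ x, ENNReal.ofReal (frobeniusNormSq (fderiv ℝ (u τ) x)) := by
            simp only [Real.enorm_eq_ofReal (frobeniusNormSq_nonneg _)]
        _ ≤ ∫⁻ τ in Ioo 0 T, ∫⁻ x, ENNReal.ofReal (frobeniusNormSq (fderiv ℝ (u τ) x)) :=
            lintegral_Ioo_mono hs ht
        _ < ⊤ := hgrad
    have hFn : ∀ n, Integrable (fun z : ℝ × (EuclideanSpace ℝ (Fin 3)) => φ n z.2 * frobeniusNormSq (fderiv ℝ (u z.1) z.2))
        μ := fun n =>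
      hGi.mono' (aestronglyMeasurable_prod_of_continuousOn
        ((((hφ1 n).continuous.comp continuous_snd).continuousOn).mul cG))
        (Eventually.of_forall fun z => by
          rw [norm_mul, Real.norm_eq_abs, Real.norm_of_nonneg (frobeniusNormSq_nonneg _)]
          exact mul_le_of_le_one_left (frobeniusNormSq_nonneg _) (hφle n _))
    have hval : ∀ n, ∫ τ in Ioo s t, ∫ x, φ n x * frobeniusNormSq (fderiv ℝ (u τ) x) =
        ∫ z, φ n z.2 * frobeniusNormSq (fderiv ℝ (u z.1) z.2) ∂μ := fun n =>
      (integral_prod _ (hFn n)).symm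
    have hlimval : (∫⁻ τ in Ioo s t, ∫⁻ x, ENNReal.ofReal (frobeniusNormSq (fderiv ℝ (u τ) x))).toReal
        = ∫ z, frobeniusNormSq (fderiv ℝ (u z.1) z.2) ∂μ := by
      rw [integral_eq_lintegral_of_nonneg_ae (Eventually.of_forall fun z => frobeniusNormSq_nonneg _)
        hGi.aestronglyMeasurable, lintegral_prod _ hGi.aestronglyMeasurable.aemeasurable.ennreal_ofReal]
    rw [hlimval]
    refine (tendsto_integral_of_dominated_convergence
      (fun z : ℝ × (EuclideanSpace ℝ (Fin 3)) => frobeniusNormSq (fderiv ℝ (u z.1) z.2))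
      (fun n => (hFn n).aestronglyMeasurable) hGi (fun n => Eventually.of_forall fun z => ?_)
      (Eventually.of_forall fun z => ?_)).congr fun n => (hval n).symm
    · rw [norm_mul, Real.norm_eq_abs, Real.norm_of_nonneg (frobeniusNormSq_nonneg _)]
      exact mul_le_of_le_one_left (frobeniusNormSq_nonneg _) (hφle n _)
    · simpa using (hφlim z.2).mul_const (frobeniusNormSq (fderiv ℝ (u z.1) z.2))
  -- (f) no force
  have lim5 : Tendsto (fun n => ∫ τ in Ioo s t, ∫ x, φ n x * ⟪(0 : ℝ → (EuclideanSpace ℝ (Fin 3)) → (EuclideanSpace ℝ (Fin 3))) τ x, u τ x⟫)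
      atTop (𝓝 0) := by
    simp only [Pi.zero_apply, inner_zero_left, mul_zero, integral_zero]
    exact tendsto_const_nhds
  -- (g) pass to the limit in the identity
  have hLHS := (limE htI).sub (limE hsI)
  have hRHS := ((((lim1.const_mul (2⁻¹ : ℝ)).sub (lim2.const_mul ν)).sub (lim3.const_mul ν)).add
    lim4).add lim5
  have heq := tendsto_nhds_unique hLHS (hRHS.congr fun n => (hid n).symm)
  linarith

end Energy



/-! ## Continuity in `L²` -/

section Continuity

open scoped RealInnerProductSpace

variable {T ν : ℝ} {u : ℝ → (EuclideanSpace ℝ (Fin 3)) → (EuclideanSpace ℝ (Fin 3))} {p : ℝ → (EuclideanSpace ℝ (Fin 3)) → ℝ}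

/-- **Continuity of the energy.** Under the energy equality, `t ↦ ½‖u(t)‖₂²` is continuous on
`[0, T]`: `|E(t) - E(t₀)| = ν∫_{[t₀,t]}∫|∇u|² → 0` by absolute continuity of the finite
dissipation integral. [folklore] -/
theorem tendsto_kineticEnergy_of_energyEq {ν : ℝ}
    (hgrad : ∫⁻ τ in Ioo 0 T, ∫⁻ x, ENNReal.ofReal (frobeniusNormSq (fderiv ℝ (u τ) x)) < ⊤)
    (hE : ∀ {s t : ℝ}, 0 ≤ s → s ≤ t → t ≤ T → VectorCalculus.kineticEnergy (u t) +
      ν * (∫⁻ τ in Ioo s t, ∫⁻ x, ENNReal.ofReal (frobeniusNormSq (fderiv ℝ (u τ) x))).toReal =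
      VectorCalculus.kineticEnergy (u s))
    {t₀ : ℝ} (ht₀ : t₀ ∈ Icc 0 T) :
    Tendsto (fun t => VectorCalculus.kineticEnergy (u t)) (𝓝[Icc 0 T] t₀) (𝓝 (VectorCalculus.kineticEnergy (u t₀))) := by
  set G : ℝ → ℝ≥0∞ := fun τ => ∫⁻ x, ENNReal.ofReal (frobeniusNormSq (fderiv ℝ (u τ) x)) with hG
  set μ : Measure ℝ := volume.restrict (Ioo 0 T) with hμ
  -- the symmetric interval around `t₀`
  set I : ℝ → Set ℝ := fun t => Ioo (min t₀ t) (max t₀ t) with hI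
  have hvol : Tendsto (μ ∘ I) (𝓝[Icc 0 T] t₀) (𝓝 0) := by
    have h1 : ∀ t, (μ ∘ I) t ≤ ENNReal.ofReal |t - t₀| := by
      intro t
      simp only [Function.comp, hμ, hI]
      calc volume.restrict (Ioo 0 T) (Ioo (min t₀ t) (max t₀ t))
          ≤ volume (Ioo (min t₀ t) (max t₀ t)) := Measure.restrict_apply_le _ _
        _ = ENNReal.ofReal |t - t₀| := by
            rw [Real.volume_Ioo, max_sub_min_eq_abs', abs_sub_comm]
    have h2 : Tendsto (fun t => ENNReal.ofReal |t - t₀|) (𝓝[Icc 0 T] t₀) (𝓝 0) := by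
      have : Tendsto (fun t : ℝ => |t - t₀|) (𝓝 t₀) (𝓝 0) := by
        have hc : Continuous fun t : ℝ => |t - t₀| := (continuous_id.sub continuous_const).abs
        simpa using hc.tendsto t₀
      have h3 := (ENNReal.continuous_ofReal.tendsto 0).comp this
      rw [ENNReal.ofReal_zero] at h3
      exact h3.mono_left nhdsWithin_le_nhds
    exact tendsto_of_tendsto_of_tendsto_of_le_of_le tendsto_const_nhds h2 (fun _ => bot_le) h1
  have hac := tendsto_setLIntegral_zero (μ := μ) (f := G) hgrad.ne hvol
  -- `|E(t) - E(t₀)| ≤ ν (∫_{I t} G).toReal`... in fact `= ± ν (∫_{I t} G).toReal`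
  have hdiff : ∀ t ∈ Icc 0 T, |VectorCalculus.kineticEnergy (u t) - VectorCalculus.kineticEnergy (u t₀)| ≤
      |ν| * (∫⁻ τ in I t, G τ ∂μ).toReal := by
    intro t ht
    have hrestr : ∀ {a b : ℝ}, 0 ≤ a → b ≤ T → ∫⁻ τ in Ioo a b, G τ ∂μ = ∫⁻ τ in Ioo a b, G τ := by
      intro a b ha hb
      rw [hμ, Measure.restrict_restrict measurableSet_Ioo,
        inter_eq_left.2 (Ioo_subset_Ioo ha hb)]
    rcases le_total t₀ t with h0 | h0
    · have e := hE ht₀.1 h0 ht.2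
      rw [hI]
      simp only [min_eq_left h0, max_eq_right h0]
      rw [hrestr ht₀.1 ht.2]
      have : VectorCalculus.kineticEnergy (u t) - VectorCalculus.kineticEnergy (u t₀) =
          -(ν * (∫⁻ τ in Ioo t₀ t, G τ).toReal) := by linarith
      rw [this, abs_neg, abs_mul, abs_of_nonneg ENNReal.toReal_nonneg]
    · have e := hE ht.1 h0 ht₀.2
      rw [hI]
      simp only [min_eq_right h0, max_eq_left h0]
      rw [hrestr ht.1 ht₀.2]
      have : VectorCalculus.kineticEnergy (u t) - VectorCalculus.kineticEnergy (u t₀) = ν * (∫⁻ τ in Ioo t t₀, G τ).toReal := by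
        linarith
      rw [this, abs_mul, abs_of_nonneg ENNReal.toReal_nonneg]
  rw [Metric.tendsto_nhdsWithin_nhds]
  intro δ hδ
  have hfin : ∀ᶠ t in 𝓝[Icc 0 T] t₀, (∫⁻ τ in I t, G τ ∂μ).toReal < δ / (|ν| + 1) := by
    have h1 : Tendsto (fun t => (∫⁻ τ in I t, G τ ∂μ).toReal) (𝓝[Icc 0 T] t₀) (𝓝 0) := by
      rw [← ENNReal.toReal_zero]
      exact (ENNReal.tendsto_toReal ENNReal.zero_ne_top).comp hac
    rw [Metric.tendsto_nhds] at h1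
    filter_upwards [h1 (δ / (|ν| + 1)) (by positivity)] with t ht
    rw [dist_zero_right, Real.norm_of_nonneg ENNReal.toReal_nonneg] at ht
    exact ht
  obtain ⟨η, hη, hηP⟩ : ∃ η > 0, ∀ t ∈ Icc 0 T, dist t t₀ < η →
      (∫⁻ τ in I t, G τ ∂μ).toReal < δ / (|ν| + 1) := by
    rw [eventually_nhdsWithin_iff, Metric.eventually_nhds_iff] at hfin
    obtain ⟨η, hη, hηP⟩ := hfin
    exact ⟨η, hη, fun t ht hd => hηP hd ht⟩
  refine ⟨η, hη, fun t ht hd => ?_⟩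
  rw [Real.dist_eq]
  calc |VectorCalculus.kineticEnergy (u t) - VectorCalculus.kineticEnergy (u t₀)| ≤ |ν| * (∫⁻ τ in I t, G τ ∂μ).toReal := hdiff t ht
    _ ≤ |ν| * (δ / (|ν| + 1)) := mul_le_mul_of_nonneg_left (hηP t ht hd).le (abs_nonneg ν)
    _ < δ := by
        rw [mul_div_assoc']
        rw [div_lt_iff₀ (by positivity)]
        nlinarith [abs_nonneg ν]

/-- **Weak `L²` continuity of finite energy classical fields.** For a jointly continuous `u` on
`[0, T] × ℝ³` with `‖u(t)‖₂² ≤ A`, and `w ∈ L²`, the map `t ↦ ∫⟪u(t), w⟫` is continuous on `[0, T]`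
(approximate `w` by compactly supported continuous fields, for which the integrand is dominated).
[folklore] -/
theorem tendsto_integral_inner_of_continuousOn
    (hu : ContinuousOn (fun z : ℝ × (EuclideanSpace ℝ (Fin 3)) => u z.1 z.2) (Icc 0 T ×ˢ univ))
    (hmem : ∀ t ∈ Icc 0 T, MemLp (u t) 2 volume) {a : ℝ} (ha : 0 ≤ a)
    (hbound : ∀ t ∈ Icc 0 T, (eLpNorm (u t) 2 volume).toReal ≤ a)
    {w : (EuclideanSpace ℝ (Fin 3)) → (EuclideanSpace ℝ (Fin 3))} (hw : MemLp w 2 volume) {t₀ : ℝ} (ht₀ : t₀ ∈ Icc 0 T) :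
    Tendsto (fun t => ∫ x, ⟪u t x, w x⟫) (𝓝[Icc 0 T] t₀) (𝓝 (∫ x, ⟪u t₀ x, w x⟫)) := by
  -- inner products through `L²`
  have hinner : ∀ {g : (EuclideanSpace ℝ (Fin 3)) → (EuclideanSpace ℝ (Fin 3))} (hg : MemLp g 2 volume) (t : ℝ) (ht : t ∈ Icc 0 T),
      ∫ x, ⟪u t x, g x⟫ = ⟪(hmem t ht).toLp (u t), hg.toLp g⟫ := by
    intro g hg t ht
    rw [MeasureTheory.L2.inner_def]
    exact integral_congr_ae (((hmem t ht).coeFn_toLp).mp ((hg.coeFn_toLp).mono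
      fun x h1 h2 => by dsimp only; rw [h1, h2]))
  have hnormU : ∀ t (ht : t ∈ Icc 0 T), ‖(hmem t ht).toLp (u t)‖ ≤ a := by
    intro t ht
    rw [Lp.norm_toLp]
    exact hbound t ht
  -- approximation error: `|∫⟪u t, w⟫ - ∫⟪u t, g⟫| ≤ a ‖w - g‖₂`
  have herr : ∀ {g : (EuclideanSpace ℝ (Fin 3)) → (EuclideanSpace ℝ (Fin 3))} (hg : MemLp g 2 volume) (t : ℝ) (ht : t ∈ Icc 0 T),
      |(∫ x, ⟪u t x, w x⟫) - ∫ x, ⟪u t x, g x⟫| ≤ a * (eLpNorm (w - g) 2 volume).toReal := by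
    intro g hg t ht
    rw [hinner hw t ht, hinner hg t ht, ← inner_sub_right, ← MemLp.toLp_sub,
      ← Lp.norm_toLp (f := w - g) (hf := hw.sub hg)]
    exact (abs_real_inner_le_norm _ _).trans (mul_le_mul_of_nonneg_right (hnormU t ht) (norm_nonneg _))
  -- continuity for compactly supported continuous `g`
  have hcont : ∀ {g : (EuclideanSpace ℝ (Fin 3)) → (EuclideanSpace ℝ (Fin 3))} (hgc : Continuous g) (hgs : HasCompactSupport g),
      ContinuousOn (fun t => ∫ x, ⟪u t x, g x⟫) (Icc 0 T) := by
    intro g hgc hgs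
    refine continuousOn_integral_of_compact_support (k := tsupport g) hgs
      (hu.inner ((hgc.comp continuous_snd).continuousOn)) ?_
    intro t x _ hx
    simp [image_eq_zero_of_notMem_tsupport hx]
  rw [Metric.tendsto_nhdsWithin_nhds]
  intro δ hδ
  -- choose `g`
  obtain ⟨g, hgs, hgε, hgc, hg2⟩ := hw.exists_hasCompactSupport_eLpNorm_sub_le ENNReal.ofNat_ne_top
    (ε := ENNReal.ofReal (δ / (3 * (a + 1)))) (by
      rw [← pos_iff_ne_zero, ENNReal.ofReal_pos]; positivity)
  have hgε' : (eLpNorm (w - g) 2 volume).toReal ≤ δ / (3 * (a + 1)) := by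
    have := ENNReal.toReal_mono ENNReal.ofReal_ne_top hgε
    rwa [ENNReal.toReal_ofReal (by positivity)] at this
  have hae : a * (eLpNorm (w - g) 2 volume).toReal ≤ δ / 3 := by
    calc a * (eLpNorm (w - g) 2 volume).toReal ≤ a * (δ / (3 * (a + 1))) :=
          mul_le_mul_of_nonneg_left hgε' ha
      _ ≤ δ / 3 := by
          rw [mul_div_assoc', div_le_div_iff₀ (by positivity) (by positivity)]
          nlinarith
  have hc := (hcont hgc hgs) t₀ ht₀
  rw [ContinuousWithinAt, Metric.tendsto_nhdsWithin_nhds] at hc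
  obtain ⟨η, hη, hηP⟩ := hc (δ / 3) (by positivity)
  refine ⟨η, hη, fun t ht hd => ?_⟩
  have h1 := herr hg2 t ht
  have h2 := herr hg2 t₀ ht₀
  have h3 := hηP ht hd
  rw [Real.dist_eq] at h3 ⊢
  have key : (∫ x, ⟪u t x, w x⟫) - ∫ x, ⟪u t₀ x, w x⟫ =
      ((∫ x, ⟪u t x, w x⟫) - ∫ x, ⟪u t x, g x⟫) + ((∫ x, ⟪u t x, g x⟫) - ∫ x, ⟪u t₀ x, g x⟫) -
        ((∫ x, ⟪u t₀ x, w x⟫) - ∫ x, ⟪u t₀ x, g x⟫) := by ring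
  rw [key]
  set X1 : ℝ := (∫ x, ⟪u t x, w x⟫) - ∫ x, ⟪u t x, g x⟫
  set X2 : ℝ := (∫ x, ⟪u t x, g x⟫) - ∫ x, ⟪u t₀ x, g x⟫
  set X3 : ℝ := (∫ x, ⟪u t₀ x, w x⟫) - ∫ x, ⟪u t₀ x, g x⟫
  have i1 : |X1 + X2 - X3| ≤ |X1 + X2| + |X3| := abs_sub _ _
  have i2 : |X1 + X2| ≤ |X1| + |X2| := abs_add_le _ _
  linarith

/-- `∫ ⟪v, v⟫ = 2 E(v)`. [folklore] -/
theorem integral_inner_self_eq_two_mul_kineticEnergy (v : (EuclideanSpace ℝ (Fin 3)) → (EuclideanSpace ℝ (Fin 3))) :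
    ∫ x, ⟪v x, v x⟫ = 2 * VectorCalculus.kineticEnergy v := by
  rw [VectorCalculus.kineticEnergy, ← mul_assoc, mul_inv_cancel₀ two_ne_zero, one_mul]
  exact integral_congr_ae (Eventually.of_forall fun x => real_inner_self_eq_norm_sq _)

/-- **Strong `L²` continuity from continuity of the energy and weak continuity** (Radon–Riesz in
the Hilbert space `L²`: `‖u(t) - u(t₀)‖₂² = ‖u(t)‖₂² - 2∫⟪u(t), u(t₀)⟫ + ‖u(t₀)‖₂² → 0`). [folklore] -/
theorem continuousInLpOn_of_energy_of_weak (hmem : ∀ t ∈ Icc 0 T, MemLp (u t) 2 volume)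
    (hKE : ∀ t₀ ∈ Icc 0 T,
      Tendsto (fun t => VectorCalculus.kineticEnergy (u t)) (𝓝[Icc 0 T] t₀) (𝓝 (VectorCalculus.kineticEnergy (u t₀))))
    (hweak : ∀ {w : (EuclideanSpace ℝ (Fin 3)) → (EuclideanSpace ℝ (Fin 3))} (_ : MemLp w 2 volume) (t₀ : ℝ) (_ : t₀ ∈ Icc 0 T),
      Tendsto (fun t => ∫ x, ⟪u t x, w x⟫) (𝓝[Icc 0 T] t₀) (𝓝 (∫ x, ⟪u t₀ x, w x⟫))) :
    ContinuousInLpOn (Icc 0 T) 2 u := by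
  classical
  refine ⟨hmem, fun t₀ ht₀ => ?_⟩
  -- the lift
  set U : ℝ → Lp (EuclideanSpace ℝ (Fin 3)) 2 (volume : Measure (EuclideanSpace ℝ (Fin 3))) := fun t =>
    if ht : t ∈ Icc 0 T then (hmem t ht).toLp (u t) else 0 with hUdef
  have hU : ∀ t (ht : t ∈ Icc 0 T), U t = (hmem t ht).toLp (u t) := fun t ht => dif_pos ht
  have hinner : ∀ (s t : ℝ) (hs : s ∈ Icc 0 T) (ht : t ∈ Icc 0 T),
      ⟪U s, U t⟫ = ∫ x, ⟪u s x, u t x⟫ := by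
    intro s t hs ht
    rw [hU s hs, hU t ht, MeasureTheory.L2.inner_def]
    exact integral_congr_ae (((hmem s hs).coeFn_toLp).mp (((hmem t ht).coeFn_toLp).mono
      fun x h1 h2 => by dsimp only; rw [h1, h2]))
  have hnorm : ∀ t (ht : t ∈ Icc 0 T), eLpNorm (u t - u t₀) 2 volume = ENNReal.ofReal ‖U t - U t₀‖ := by
    intro t ht
    rw [hU t ht, hU t₀ ht₀, ← MemLp.toLp_sub, Lp.norm_toLp,
      ENNReal.ofReal_toReal ((hmem t ht).sub (hmem t₀ ht₀)).eLpNorm_ne_top]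
  -- `‖U t - U t₀‖² → 0`
  have hsq : ∀ t ∈ Icc 0 T, ‖U t - U t₀‖ ^ 2 =
      2 * VectorCalculus.kineticEnergy (u t) - 2 * (∫ x, ⟪u t x, u t₀ x⟫) + 2 * VectorCalculus.kineticEnergy (u t₀) := by
    intro t ht
    rw [norm_sub_sq_real, ← real_inner_self_eq_norm_sq, ← real_inner_self_eq_norm_sq,
      hinner t t ht ht, hinner t t₀ ht ht₀, hinner t₀ t₀ ht₀ ht₀,
      integral_inner_self_eq_two_mul_kineticEnergy, integral_inner_self_eq_two_mul_kineticEnergy]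
  have hlim : Tendsto (fun t => ‖U t - U t₀‖ ^ 2) (𝓝[Icc 0 T] t₀) (𝓝 0) := by
    have h1 := ((hKE t₀ ht₀).const_mul 2).sub ((hweak (hmem t₀ ht₀) t₀ ht₀).const_mul 2)
    have h2 := h1.add (tendsto_const_nhds (x := 2 * VectorCalculus.kineticEnergy (u t₀)))
    rw [integral_inner_self_eq_two_mul_kineticEnergy] at h2
    have h0 : 2 * VectorCalculus.kineticEnergy (u t₀) - 2 * (2 * VectorCalculus.kineticEnergy (u t₀)) + 2 * VectorCalculus.kineticEnergy (u t₀) = 0 := by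
      ring
    rw [h0] at h2
    refine h2.congr' ?_
    exact eventually_mem_nhdsWithin.mono fun t ht => (hsq t ht).symm
  have hlim' : Tendsto (fun t => ‖U t - U t₀‖) (𝓝[Icc 0 T] t₀) (𝓝 0) := by
    have h := (Real.continuous_sqrt.tendsto 0).comp hlim
    rw [Real.sqrt_zero] at h
    refine h.congr fun t => ?_
    simp [Real.sqrt_sq (norm_nonneg _)]
  have hlim'' := (ENNReal.continuous_ofReal.tendsto 0).comp hlim'
  rw [ENNReal.ofReal_zero] at hlim''
  refine hlim''.congr' ?_
  exact eventually_mem_nhdsWithin.mono fun t ht => (hnorm t ht).symm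

end Continuity


/-! ## Finite energy classical solutions are Leray–Hopf solutions -/

section Assembly

open scoped RealInnerProductSpace

variable {T ν : ℝ} {u : ℝ → (EuclideanSpace ℝ (Fin 3)) → (EuclideanSpace ℝ (Fin 3))} {p : ℝ → (EuclideanSpace ℝ (Fin 3)) → ℝ}

/-- `‖u(t)‖₂ ≤ A^{1/2}` from `∫|u(t)|² ≤ A`. [folklore] -/
theorem toReal_eLpNorm_two_le {v : (EuclideanSpace ℝ (Fin 3)) → (EuclideanSpace ℝ (Fin 3))} {A : ℝ≥0∞} (hAt : A ≠ ⊤) (h : ∫⁻ x, ‖v x‖ₑ ^ 2 ≤ A) :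
    (eLpNorm v 2 volume).toReal ≤ (A ^ (1 / 2 : ℝ)).toReal := by
  refine ENNReal.toReal_mono (ENNReal.rpow_ne_top_of_nonneg (by norm_num) hAt) ?_
  rw [eLpNorm_eq_lintegral_rpow_enorm_toReal two_ne_zero ENNReal.ofNat_ne_top]
  have h2 : (2 : ℝ≥0∞).toReal = 2 := by norm_num
  rw [h2]
  refine ENNReal.rpow_le_rpow ?_ (by norm_num)
  simpa only [ENNReal.rpow_two] using h

/-- **Finite energy classical solutions are Leray–Hopf solutions — core statement.** Given Tao's
pressure normalisation (Lemma 4.1 (i)) and the estimate of the pressure term `X₅` (both proved in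
the tree), a classical solution of the unforced system on `[0, T] × ℝ³` with
`sup_t ∫|u(t)|² ≤ A < ∞` and `∇u ∈ L²_{t,x}` is a Leray–Hopf weak solution on `[0, T)` from `u(0)`
(with energy *equality* from every time), and `u ∈ C([0,T]; L²)`. [cite: Tao2011, Lemma 8.1 + Lemma 4.1 (i)] -/
theorem IsClassicalNSSolutionOn.isLerayHopfOn_of_finiteEnergy' (hP : FluidPDE.tao_pressure_normalisation)
    (hX5 : FluidPDE.tao2011_pressureTerm_estimate)
    (h : IsClassicalNSSolutionOn (Icc 0 T) ν 0 u p) (hν : 0 < ν) (hT : 0 < T)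
    {A : ℝ≥0∞} (hAt : A ≠ ⊤) (hA : ∀ t ∈ Icc 0 T, ∫⁻ x, ‖u t x‖ₑ ^ 2 ≤ A)
    (hgrad : ∫⁻ τ in Ioo 0 T, ∫⁻ x, ENNReal.ofReal (frobeniusNormSq (fderiv ℝ (u τ) x)) < ⊤) :
    IsLerayHopfOn T ν 0 (u 0) u ∧ ContinuousInLpOn (Icc 0 T) 2 u := by
  have hU : UniqueDiffOn ℝ (Icc 0 T) := uniqueDiffOn_Icc hT
  have h0I : (0 : ℝ) ∈ Icc 0 T := left_mem_Icc.2 hT.le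
  have hfilter : 𝓝[>] (0 : ℝ) ≤ 𝓝[Icc 0 T] 0 :=
    nhdsWithin_le_of_mem (mem_of_superset (Ioo_mem_nhdsGT hT) Ioo_subset_Icc_self)
  have hu₃ := h.lintegral_enorm_pow_three_lt_top hAt hA hgrad
  have hmem : ∀ t ∈ Icc 0 T, MemLp (u t) 2 volume := fun t ht =>
    memLp_two_of_lintegral_lt_top (h.contDiff_velocity ht).continuous ((hA t ht).trans_lt hAt.lt_top)
  -- the energy equality on every `[s, t] ⊆ [0, T]`
  have hE : ∀ {s t : ℝ}, 0 ≤ s → s ≤ t → t ≤ T → VectorCalculus.kineticEnergy (u t) +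
      ν * (∫⁻ τ in Ioo s t, ∫⁻ x, ENNReal.ofReal (frobeniusNormSq (fderiv ℝ (u τ) x))).toReal =
      VectorCalculus.kineticEnergy (u s) := fun hs hst ht =>
    h.energyEq_of_finiteEnergy hP hX5 hν hT hAt hA hgrad hu₃ hs hst ht
  -- continuity in `L²`
  have hKE : ∀ t₀ ∈ Icc 0 T,
      Tendsto (fun t => VectorCalculus.kineticEnergy (u t)) (𝓝[Icc 0 T] t₀) (𝓝 (VectorCalculus.kineticEnergy (u t₀))) :=
    fun t₀ ht₀ => tendsto_kineticEnergy_of_energyEq hgrad hE ht₀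
  have hweak : ∀ {w : (EuclideanSpace ℝ (Fin 3)) → (EuclideanSpace ℝ (Fin 3))} (_ : MemLp w 2 volume) (t₀ : ℝ) (_ : t₀ ∈ Icc 0 T),
      Tendsto (fun t => ∫ x, ⟪u t x, w x⟫) (𝓝[Icc 0 T] t₀) (𝓝 (∫ x, ⟪u t₀ x, w x⟫)) :=
    fun hw t₀ ht₀ => tendsto_integral_inner_of_continuousOn h.smooth_velocity.continuousOn hmem
      ENNReal.toReal_nonneg (fun t ht => toReal_eLpNorm_two_le hAt (hA t ht)) hw ht₀
  have hcont : ContinuousInLpOn (Icc 0 T) 2 u := continuousInLpOn_of_energy_of_weak hmem hKE hweak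
  -- no force
  have hz : ∀ a b : ℝ, ∫ τ in a..b, ∫ x, ⟪(0 : ℝ → (EuclideanSpace ℝ (Fin 3)) → (EuclideanSpace ℝ (Fin 3))) τ x, u τ x⟫ = 0 := by
    intro a b
    simp
  refine ⟨⟨IsClassicalNSSolutionOn.isWeakNSSolutionOn_holds h Subset.rfl, ⟨A.toNNReal, ?_⟩, hmem,
    ⟨fun t => fderiv ℝ (u t), ?_, hgrad, fun t ht => ?_, ?_⟩, fun w hw => ⟨?_, ?_⟩, ?_⟩, hcont⟩
  · -- energy bound a.e. on `(0, T)`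
    refine (ae_restrict_iff' measurableSet_Ioo).2 (Eventually.of_forall fun t ht => ?_)
    rw [ENNReal.coe_toNNReal hAt]
    exact hA t (Ioo_subset_Icc_self ht)
  · -- the classical gradient is a weak gradient
    exact (ae_restrict_iff' measurableSet_Ioo).2 (Eventually.of_forall fun t ht =>
      hasWeakGradient_fderiv_of_contDiff
        (contDiff_infty.1 (h.contDiff_velocity (Ioo_subset_Icc_self ht)) 1))
  · -- energy (in)equality from `0`
    rw [hz, add_zero]
    exact (hE le_rfl ht.1 ht.2).le
  · -- energy (in)equality from every `s ∈ (0, T)`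
    exact (ae_restrict_iff' measurableSet_Ioo).2 (Eventually.of_forall fun s hs t ht => by
      rw [hz, add_zero]
      exact (hE hs.1.le ht.1 ht.2).le)
  · -- weak continuity on `(0, T]`
    intro t ht
    exact (hweak hw t (Ioc_subset_Icc_self ht)).mono_left (nhdsWithin_mono _ Ioc_subset_Icc_self)
  · -- weak attainment of the datum
    exact (hweak hw 0 h0I).mono_left hfilter
  · -- strong attainment of the datum
    exact (hcont.2 0 h0I).mono_left hfilter

/-- From Lemma 8.1 (`tao_finite_energy_smooth_energy_bound`): the uniform energy bound
`A = C ∫|u₀|²` and `∇u ∈ L²_{t,x}` for a finite energy classical solution. [cite: Tao2011, Lemma 8.1] -/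
theorem IsClassicalNSSolutionOn.energyClass_of_finiteEnergy (hL : FluidPDE.tao_finite_energy_smooth_energy_bound)
    (h : IsClassicalNSSolutionOn (Icc 0 T) ν 0 u p) (hν : 0 < ν) (hT : 0 < T)
    (hfe : ∃ A : ℝ≥0∞, A < ⊤ ∧ ∀ t ∈ Icc 0 T, ∫⁻ x, ‖u t x‖ₑ ^ 2 ≤ A) :
    ∃ A : ℝ≥0∞, A ≠ ⊤ ∧ (∀ t ∈ Icc 0 T, ∫⁻ x, ‖u t x‖ₑ ^ 2 ≤ A) ∧
      ENNReal.ofReal ν * ∫⁻ τ in Ioo 0 T, ∫⁻ x, ENNReal.ofReal (frobeniusNormSq (fderiv ℝ (u τ) x)) ≤ A ∧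
      ∫⁻ τ in Ioo 0 T, ∫⁻ x, ENNReal.ofReal (frobeniusNormSq (fderiv ℝ (u τ) x)) < ⊤ := by
  obtain ⟨C, hC, hmain⟩ := hL
  obtain ⟨hEt, hD⟩ := hmain ν T hν hT u p h hfe
  obtain ⟨A₀, hA₀, hA₀t⟩ := hfe
  set A := C * ∫⁻ x, ‖u 0 x‖ₑ ^ 2 with hAdef
  have hAt : A ≠ ⊤ := ENNReal.mul_ne_top hC.ne ((hA₀t 0 ⟨le_rfl, hT.le⟩).trans_lt hA₀).ne
  have hν' : ENNReal.ofReal ν ≠ 0 := (ENNReal.ofReal_pos.2 hν).ne'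
  have hgrad : ∫⁻ τ in Ioo 0 T, ∫⁻ x, ENNReal.ofReal (frobeniusNormSq (fderiv ℝ (u τ) x)) < ⊤ := by
    have hle : ∫⁻ τ in Ioo 0 T, ∫⁻ x, ENNReal.ofReal (frobeniusNormSq (fderiv ℝ (u τ) x)) ≤
        A / ENNReal.ofReal ν := by
      rw [ENNReal.le_div_iff_mul_le (Or.inl hν') (Or.inl ENNReal.ofReal_ne_top), mul_comm]
      exact hD
    exact hle.trans_lt (ENNReal.div_lt_top hAt hν')
  exact ⟨A, hAt, hEt, hD, hgrad⟩

/-- **Finite energy classical solutions are Leray–Hopf solutions** (Tao 2011, Lemma 8.1 in the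
sharp form, with Lemma 4.1 (i); Leray 1934, §32). Given the three named facts — Lemma 4.1 (i)
`NS.tao_pressure_normalisation`, the estimate of `X₅` `NS.tao2011_pressureTerm_estimate` and
Lemma 8.1 `NS.tao_finite_energy_smooth_energy_bound`, all three theorems of the tree — every
classical solution of the unforced Navier–Stokes system on `[0, T] × ℝ³` with
`sup_{t ∈ [0,T]} ∫|u(t)|² < ∞` is a Leray–Hopf weak solution on `[0, T)` from `u(0)`, with
`u ∈ C([0,T]; L²)`. [cite: Tao2011, Lemma 8.1 + Lemma 4.1 (i)] -/
theorem IsClassicalNSSolutionOn.isLerayHopfOn_of_finiteEnergy (hP : FluidPDE.tao_pressure_normalisation)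
    (hX5 : FluidPDE.tao2011_pressureTerm_estimate) (hL : FluidPDE.tao_finite_energy_smooth_energy_bound)
    (h : IsClassicalNSSolutionOn (Icc 0 T) ν 0 u p) (hν : 0 < ν) (hT : 0 < T)
    (hfe : ∃ A : ℝ≥0∞, A < ⊤ ∧ ∀ t ∈ Icc 0 T, ∫⁻ x, ‖u t x‖ₑ ^ 2 ≤ A) :
    IsLerayHopfOn T ν 0 (u 0) u ∧ ContinuousInLpOn (Icc 0 T) 2 u := by
  obtain ⟨A, hAt, hA, -, hgrad⟩ := h.energyClass_of_finiteEnergy hL hν hT hfe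
  exact h.isLerayHopfOn_of_finiteEnergy' hP hX5 hν hT hAt hA hgrad

/-- **Time translates.** Under the same facts, for `0 ≤ t' < T` the translate `u(· + t')` of a
finite energy classical solution on `[0, T] × ℝ³` is a Leray–Hopf weak solution on `[0, T - t')`
from `u(t')`, continuous into `L²` on `[0, T - t']` (the system is autonomous:
`IsClassicalNSSolutionOn.comp_add_right`). [cite: Tao2011, Lemma 8.1 + Lemma 4.1 (i)] -/
theorem IsClassicalNSSolutionOn.isLerayHopfOn_translate_of_finiteEnergy
    (hP : FluidPDE.tao_pressure_normalisation) (hX5 : FluidPDE.tao2011_pressureTerm_estimate)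
    (hL : FluidPDE.tao_finite_energy_smooth_energy_bound)
    (h : IsClassicalNSSolutionOn (Icc 0 T) ν 0 u p) (hν : 0 < ν) {t' : ℝ} (ht'0 : 0 ≤ t')
    (ht'T : t' < T) (hfe : ∃ A : ℝ≥0∞, A < ⊤ ∧ ∀ t ∈ Icc 0 T, ∫⁻ x, ‖u t x‖ₑ ^ 2 ≤ A) :
    IsLerayHopfOn (T - t') ν 0 (u t') (fun t => u (t + t')) ∧
      ContinuousInLpOn (Icc 0 (T - t')) 2 (fun t => u (t + t')) := by
  have hT' : 0 < T - t' := by linarith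
  have h' : IsClassicalNSSolutionOn (Icc 0 (T - t')) ν 0 (fun t => u (t + t')) (fun t => p (t + t')) :=
    (h.comp_add_right t').mono (fun t ht => ⟨by linarith [ht.1], by linarith [ht.2]⟩)
      (uniqueDiffOn_Icc hT')
  have hfe' : ∃ A : ℝ≥0∞, A < ⊤ ∧ ∀ t ∈ Icc 0 (T - t'), ∫⁻ x, ‖u (t + t') x‖ₑ ^ 2 ≤ A := by
    obtain ⟨A, hA, hAt⟩ := hfe
    exact ⟨A, hA, fun t ht => hAt (t + t') ⟨by linarith [ht.1], by linarith [ht.2]⟩⟩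
  have := h'.isLerayHopfOn_of_finiteEnergy hP hX5 hL hν hT' hfe'
  simpa only [zero_add] using this

end Assembly

end Literature.Analysis.FluidPDE

/-! ## With the discharged facts -/

namespace Literature.Analysis.FluidPDE

open VectorCalculus LerayHopfProofs

/-- The estimate of the pressure term `X₅` (`tao2011_pressureTerm_estimate`) is a theorem of the
tree: `tao2011_pressureTerm_estimate_of_riesz` with the two discharged singular-integral inputs
`hasPressurePV_of_contDiff_holds` and `stein1970_normalisedPressure_eLpNorm_le_holds`. [cite: Tao2011, §8, proof of Lemma 8.1, (64)–(65)] -/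
theorem tao2011_pressureTerm_estimate_holds : tao2011_pressureTerm_estimate :=
  tao2011_pressureTerm_estimate_of_riesz hasPressurePV_of_contDiff_holds
    stein1970_normalisedPressure_eLpNorm_le_holds

variable {T ν : ℝ} {u : ℝ → EuclideanSpace ℝ (Fin 3) → EuclideanSpace ℝ (Fin 3)}
  {p : ℝ → EuclideanSpace ℝ (Fin 3) → ℝ}

/-- **Finite energy classical solutions are Leray–Hopf solutions — unconditionally** (all three
inputs discharged: `tao_pressure_normalisation_holds`, `tao2011_pressureTerm_estimate_holds`,
`tao_finite_energy_smooth_energy_bound_holds`). [cite: Tao2011, Lemma 8.1 + Lemma 4.1 (i)] -/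
theorem isLerayHopfOn_of_finiteEnergy (h : IsClassicalNSSolutionOn (Icc 0 T) ν 0 u p) (hν : 0 < ν)
    (hT : 0 < T) (hfe : ∃ A : ℝ≥0∞, A < ⊤ ∧ ∀ t ∈ Icc 0 T, ∫⁻ x, ‖u t x‖ₑ ^ 2 ≤ A) :
    IsLerayHopfOn T ν 0 (u 0) u ∧ ContinuousInLpOn (Icc 0 T) 2 u :=
  h.isLerayHopfOn_of_finiteEnergy tao_pressure_normalisation_holds tao2011_pressureTerm_estimate_holds
    tao_finite_energy_smooth_energy_bound_holds hν hT hfe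

/-- **Time translates, unconditionally.** [cite: Tao2011, Lemma 8.1 + Lemma 4.1 (i)] -/
theorem isLerayHopfOn_translate_of_finiteEnergy (h : IsClassicalNSSolutionOn (Icc 0 T) ν 0 u p)
    (hν : 0 < ν) {t' : ℝ} (ht'0 : 0 ≤ t') (ht'T : t' < T)
    (hfe : ∃ A : ℝ≥0∞, A < ⊤ ∧ ∀ t ∈ Icc 0 T, ∫⁻ x, ‖u t x‖ₑ ^ 2 ≤ A) :
    IsLerayHopfOn (T - t') ν 0 (u t') (fun t => u (t + t')) ∧
      ContinuousInLpOn (Icc 0 (T - t')) 2 (fun t => u (t + t')) :=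
  h.isLerayHopfOn_translate_of_finiteEnergy tao_pressure_normalisation_holds
    tao2011_pressureTerm_estimate_holds tao_finite_energy_smooth_energy_bound_holds hν ht'0 ht'T hfe

/-- **The energy class of a finite energy classical solution, unconditionally** (Lemma 8.1):
`sup_t ∫|u(t)|² ≤ A`, `ν∫₀ᵀ∫|∇u|² ≤ A`, `A = C∫|u₀|² < ∞`. [cite: Tao2011, Lemma 8.1] -/
theorem energyClass_of_finiteEnergy (h : IsClassicalNSSolutionOn (Icc 0 T) ν 0 u p) (hν : 0 < ν)
    (hT : 0 < T) (hfe : ∃ A : ℝ≥0∞, A < ⊤ ∧ ∀ t ∈ Icc 0 T, ∫⁻ x, ‖u t x‖ₑ ^ 2 ≤ A) :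
    ∃ A : ℝ≥0∞, A ≠ ⊤ ∧ (∀ t ∈ Icc 0 T, ∫⁻ x, ‖u t x‖ₑ ^ 2 ≤ A) ∧
      ENNReal.ofReal ν * ∫⁻ τ in Ioo 0 T, ∫⁻ x, ENNReal.ofReal (frobeniusNormSq (fderiv ℝ (u τ) x)) ≤ A ∧
      ∫⁻ τ in Ioo 0 T, ∫⁻ x, ENNReal.ofReal (frobeniusNormSq (fderiv ℝ (u τ) x)) < ⊤ :=
  h.energyClass_of_finiteEnergy tao_finite_energy_smooth_energy_bound_holds hν hT hfe

end Literature.Analysis.FluidPDE
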